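import Summits.ABC.IUTFork.LDHCor312
import Mathlib.Tactic.Linarith
import HarnessLib

/-!
# The fork at [IUTchIII] Corollary 3.12, L-DH level (c312-3), II-b: the prime set of `Cor312DH` —
# restriction to `T`, monotonicity in `T`, stabilisation, and (1.1) with `Σ_p` (referee finding R7-C3-F1)

Record-only file (D-0012) of the abc-iut cell (Cor. 3.12 sub-crew, seat abc-iut-c312-3); TAKES NO SIDE.
Companion of `LDHCor312` (whose declarations it leaves untouched).

Dupuy–Hilado sum `ln ν̄_𝕃(hull(U_Θ)) := Σ_p ln ν̄_{𝕃_p}(hull(U_Θ)_p)` over ALL primes `p` (§1 p. 4; Def. 3.6.3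
"`𝕃 = Π_p 𝕃_p`, `ln ν̄_𝕃(B) = Σ_p ln ν̄_{𝕃_p}(B_p)`"; "possibly `p = ∞`" is out of scope in this file), whereas
`LDHCor312`'s `DHData.negLogThetaDH` / `DHData.Cor312DH` sum over the datum's finite set `T ⊇ {p_v : v ∈ S}` only. The cell's
audit (seat abc-iut-L6-t24, finding R7-C3-F1) observes — correctly — that the omitted summands are `≥ 0`
and need not vanish: at the primes of [IUTchIV]'s `V^dst` outside `T` the (Ind2)/(Ind3)-inflation of
the log-shell is positive ([IUTchIV] Thm. 1.10, Step (v), kurims pp. 27–29, where the terms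
`log(𝔡^K_v)` enter at every `v ∈ V^dst`). Hence `Cor312DH` is (1.1) RESTRICTED TO `T`: a STRONGER
inequality than (1.1), equal to it exactly when `T` carries the support of `hull(U_Θ)`; a refutation of
`Cor312DH` for a datum with minimal `T` would NOT refute (1.1), while a proof of `Cor312DHOn T'` for any
one `T' ⊇ T` proves it. This file makes that precise WITHOUT touching `LDHCor312`:
the family `Cor312DHOn T'` (`T'` any finite set of primes; `Cor312DH = Cor312DHOn T`), PROVED monotone
in `T'` (each extra summand is `ln ν̄_{𝕃_p}(hull(U_Θ)_p) ≥ ln ν̄_{𝕃_p}(O_𝕃(−P_Θ)_p) = 0` for `p ∉ T`,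
since `P_Θ` is supported on `S`); the support hypothesis `HullSupportedOn T₀` (off `T₀` every component
of `hull(U_Θ)` has `log μ̄ = 0` — the content of [IUTchIV] Prop. 1.4 (iv) / Thm. 1.10 Step (vi) off
`V^dst`; an obligation of the concrete model, NOT assumed anywhere) under which the truncations
STABILISE, so that the finite sum over `T₀` is DH's `Σ_p`; and (1.1) with `Σ_p` read as the limit of its
monotone truncations (`Cor312DHLim`), PROVED equivalent to `Cor312DHOn T₀` under `HullSupportedOn T₀`.
The squeeze of `LDHCor312` §5 is re-derived over `T'` (`ndeg_qPilot_le_of_squeezeOn`): a discrepancy `δ` proved over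
`T' ⊇ V^dst` carries the log-different terms of [IUTchIV] Thm. 1.10.

Sources read on the page: Dupuy–Hilado arXiv:2004.13228 (pre-split text) §1 pp. 3–4, Def. 3.6.3, §3.9,
Thm. 3.10.1 (corpus render `paper:arxiv-2004.13228`); [IUTchIV] Prop. 1.4 (iv) p. 13, Thm. 1.10 Step (v)–(vi)
pp. 27–29 (kurims `paper:url-56bcb0f95768`). [cite: DupuyHilado2025, §1 (1.1), Def. 3.6.3, Thm. 3.10.1]
[claim: Mochizuki2012, status: disputed] Deliberately NOT here: archimedean summands; which `T₀` the real
model supports the hull on (an instance-level theorem of the tensor-packet model); any judgement.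
-/

noncomputable section

open Set Finset

namespace Summit.ABC.IUTFork

open Literature.IUT.LogVolume NumberField IsDedekindDomain

variable {F : Type} [Field F] [NumberField F]

namespace DHData

variable (D : DHData F)

/-! ## 1. Truncations of the two sides of (1.1) to an arbitrary finite set of primes -/

/-- `ln ν̄_{𝕃,T'}(hull(U_Θ))`: the theta side of (1.1) truncated to an ARBITRARY finite set of primes `T'`
(`negLogThetaDH` is the case `T' = T`). [cite: DupuyHilado2025, §1 p. 4, Def. 3.6.3] -/
def negLogThetaDHOn (T' : Finset ℕ) : ℝ := D.M.lnνL D.X.lstar T' (D.M.hullUTheta D.ind3)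

/-- `ln ν̄_{𝕃,T'}(O_𝕃(−P_q))`: the `q`-side truncated to `T'` (`negAbsLogqDH` is the case `T' = T`).
[cite: DupuyHilado2025, §3.9, Def. 3.6.3] -/
def negAbsLogqDHOn (T' : Finset ℕ) : ℝ := D.M.lnνL D.X.lstar T' (D.M.region D.tq)

/-- **(1.1) truncated to `T'`**: `−deĝ̲(P_q) ≤ ln ν̄_{𝕃,T'}(hull(U_Θ))`. HYPOTHESIS, never asserted; for
`T' = T` it is `Cor312DH`; it is (1.1) as printed exactly when `T'` carries the support of `hull(U_Θ)`
(`cor312DHLim_iff_of_hullSupportedOn`). [claim: Mochizuki2012, status: disputed] -/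
@[claim "Mochizuki2012" "disputed"]
def Cor312DHOn (T' : Finset ℕ) : Prop := -FinDivisor.ndeg F D.X.qPilot ≤ D.negLogThetaDHOn T'

/-- `negLogThetaDH = negLogThetaDHOn T`. [cite: DupuyHilado2025, §1 p. 4] -/
theorem negLogThetaDHOn_self : D.negLogThetaDHOn D.T = D.negLogThetaDH := rfl

/-- `negAbsLogqDH = negAbsLogqDHOn T`. [cite: DupuyHilado2025, §3.9] -/
theorem negAbsLogqDHOn_self : D.negAbsLogqDHOn D.T = D.negAbsLogqDH := rfl

/-- `Cor312DH` IS the truncation to `T`: `Cor312DHOn T ↔ Cor312DH`. [claim: Mochizuki2012, status: disputed] -/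
theorem cor312DHOn_self_iff : D.Cor312DHOn D.T ↔ D.Cor312DH := Iff.rfl

/-- The theta-pilot divisors are supported on `S`: `P_{Θ,j}(v) = 0` for `v ∉ S`.
[cite: DupuyHilado2025, §3.3] -/
theorem thetaPilot_apply_of_not_mem {v : HeightOneSpectrum (𝓞 F)} (hv : v ∉ D.X.S)
    (i : Fin D.X.lstar) : D.X.thetaPilot i v = 0 := by
  classical
  show (∑ w ∈ D.X.S,
    FinDivisor.of w ((((i : ℕ) + 1 : ℝ) ^ 2) * (D.X.ordq w : ℝ) / (2 * D.X.l))) v = 0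
  rw [Finsupp.finsetSum_apply]
  exact Finset.sum_eq_zero fun w hw => by
    rw [FinDivisor.of, Finsupp.single_apply, if_neg (show ¬ (w = v) from fun hwv => hv (hwv ▸ hw))]

/-- The `q`-pilot divisor is supported on `S`: `P_q(v) = 0` for `v ∉ S`. [cite: DupuyHilado2025, §3.3] -/
theorem qPilot_apply_of_not_mem {v : HeightOneSpectrum (𝓞 F)} (hv : v ∉ D.X.S) : D.X.qPilot v = 0 := by
  classical
  show (∑ w ∈ D.X.S, FinDivisor.of w ((D.X.ordq w : ℝ) / (2 * D.X.l))) v = 0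
  rw [Finsupp.finsetSum_apply]
  exact Finset.sum_eq_zero fun w hw => by
    rw [FinDivisor.of, Finsupp.single_apply, if_neg (show ¬ (w = v) from fun hwv => hv (hwv ▸ hw))]

/-- A place over a prime `p ∉ T` is not a bad place (`T` contains the residue characteristics of `S`).
[cite: DupuyHilado2025, §3.9] -/
theorem not_mem_S_of_not_mem {p : ℕ} (hp : p.Prime) (hpT : p ∉ D.T) (v : placesOver F p) :
    v.1 ∉ D.X.S := by
  intro hv
  haveI : Fact p.Prime := ⟨hp⟩
  have h := D.S_sub v.1 hv
  rw [(mem_placesOver_iff_residueChar v.1).mp v.2] at h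
  exact hpT h

/-- Off `T`, the `p`-part of the bare theta region has `ln ν̄_{𝕃_p}(O_𝕃(−P_Θ)_p) = 0` (Thm. 3.10.1 at `p`;
`P_Θ` is supported on `S`, whose residue characteristics lie in `T`). [cite: DupuyHilado2025, Thm. 3.10.1] -/
theorem lnνLp_regionΘ_eq_zero {p : ℕ} (hp : p.Prime) (hpT : p ∉ D.T) :
    D.M.lnνLp D.X.lstar p (D.M.region D.tΘ) = 0 := by
  haveI : Fact p.Prime := ⟨hp⟩
  rw [D.M.lnνLp_region D.tΘ p]
  have h : ∀ i : Fin D.X.lstar,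
      (∑ v : placesOver F p, FinDivisor.of v.1 (D.M.ordv (D.tΘ i p v))) = 0 := by
    intro i
    refine Finset.sum_eq_zero fun v _ => ?_
    rw [D.tΘ_ord i p v, D.thetaPilot_apply_of_not_mem (D.not_mem_S_of_not_mem hp hpT v) i]
    exact Finsupp.single_zero v.1
  simp only [h, map_zero, Finset.sum_const_zero, mul_zero]

/-- **The omitted summands are nonnegative**: off `T`, `0 ≤ ln ν̄_{𝕃_p}(hull(U_Θ)_p)` — the hull contains
the identity image, which contains `O_𝕃(−P_Θ)`, whose `p`-part has log-volume `0` there; `log μ̄` is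
monotone. [cite: DupuyHilado2025, Def. 3.6.3, §4.10–4.12] -/
theorem lnνLp_hullUTheta_nonneg {p : ℕ} (hp : p.Prime) (hpT : p ∉ D.T) :
    0 ≤ D.M.lnνLp D.X.lstar p (D.M.hullUTheta D.ind3) := by
  rw [← D.lnνLp_regionΘ_eq_zero hp hpT]
  refine D.M.lnνLp_mono D.X.lstar p (D.M.region_adm D.tΘ) D.hull_adm fun p j e => ?_
  exact (D.M.region_subset_UTheta_one D.ind3 p j e).trans (D.M.UTheta_le_hullUTheta D.ind3 _ p j e)

/-- **Monotonicity in the prime set**: for `T ⊆ T₁ ⊆ T₂` (`T₂` consisting of primes),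
`ln ν̄_{𝕃,T₁}(hull(U_Θ)) ≤ ln ν̄_{𝕃,T₂}(hull(U_Θ))`. [cite: DupuyHilado2025, Def. 3.6.3] -/
theorem negLogThetaDHOn_mono {T₁ T₂ : Finset ℕ} (h₁ : D.T ⊆ T₁) (h₁₂ : T₁ ⊆ T₂)
    (hT₂ : ∀ p ∈ T₂, p.Prime) : D.negLogThetaDHOn T₁ ≤ D.negLogThetaDHOn T₂ := by
  unfold negLogThetaDHOn PacketModel.lnνL
  exact Finset.sum_le_sum_of_subset_of_nonneg h₁₂ fun p hp₂ hp₁ =>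
    D.lnνLp_hullUTheta_nonneg (hT₂ p hp₂) (fun hpT => hp₁ (h₁ hpT))

/-- `div_{T'}(t_Θ) = P_Θ` for every finite set of primes `T' ⊇ T`. [cite: DupuyHilado2025, §3.9] -/
theorem div_tΘ_of_subset {T' : Finset ℕ} (hT' : ∀ p ∈ T', p.Prime) (h : D.T ⊆ T') :
    PacketModel.LgpIdele.div D.M.toPacketModel D.tΘ T' = D.X.thetaPilot := by
  funext i
  unfold PacketModel.LgpIdele.div
  simp_rw [D.tΘ_ord i]
  refine sum_sum_placesOver_of (D.X.thetaPilot i) T' hT' fun v hv => h (D.S_sub v ?_)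
  by_contra hS
  exact hv (D.thetaPilot_apply_of_not_mem hS i)

/-- `div_{T'}(t_q) = (P_q, …, P_q)` for every finite set of primes `T' ⊇ T`. [cite: DupuyHilado2025, §3.9] -/
theorem div_tq_of_subset {T' : Finset ℕ} (hT' : ∀ p ∈ T', p.Prime) (h : D.T ⊆ T') :
    PacketModel.LgpIdele.div D.M.toPacketModel D.tq T' = fun _ => D.X.qPilot := by
  funext i
  unfold PacketModel.LgpIdele.div
  simp_rw [D.tq_ord i]
  refine sum_sum_placesOver_of D.X.qPilot T' hT' fun v hv => h (D.S_sub v ?_)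
  by_contra hS
  exact hv (D.qPilot_apply_of_not_mem hS)

/-- Thm. 3.10.1 at `P_Θ` over any `T' ⊇ T`: `ln ν̄_{𝕃,T'}(O_𝕃(−P_Θ)) = −deĝ̲_lgp(P_Θ)` (independent of `T'`).
[cite: DupuyHilado2025, Thm. 3.10.1] -/
theorem lnνL_regionΘ_on {T' : Finset ℕ} (hT' : ∀ p ∈ T', p.Prime) (h : D.T ⊆ T') :
    D.M.lnνL D.X.lstar T' (D.M.region D.tΘ) = -LgpDivisor.ndegLgp D.X.thetaPilot := by
  rw [D.M.lnνL_region_eq_neg_ndegLgp D.tΘ T' hT', D.div_tΘ_of_subset hT' h]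

/-- Thm. 3.10.1 at `P_q` over any `T' ⊇ T`: `ln ν̄_{𝕃,T'}(O_𝕃(−P_q)) = −deĝ̲(P_q)` — the `q`-side of (1.1) does
NOT depend on the prime set. [cite: DupuyHilado2025, Thm. 3.10.1] -/
theorem negAbsLogqDHOn_eq {T' : Finset ℕ} (hT' : ∀ p ∈ T', p.Prime) (h : D.T ⊆ T') :
    D.negAbsLogqDHOn T' = -FinDivisor.ndeg F D.X.qPilot := by
  haveI : NeZero D.X.lstar := ⟨by have := D.X.two_le_lstar; omega⟩
  rw [negAbsLogqDHOn, D.M.lnνL_region_eq_neg_ndegLgp D.tq T' hT', D.div_tq_of_subset hT' h,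
    LgpDivisor.ndegLgp_eq, LgpDivisor.degLgp_const, FinDivisor.ndeg_apply]

/-- The truncated (1.1) in log-volume form: `ln ν̄_{𝕃,T'}(O_𝕃(−P_q)) ≤ ln ν̄_{𝕃,T'}(hull(U_Θ))`.
[cite: DupuyHilado2025, §1 (1.1), Thm. 3.10.1] -/
theorem cor312DHOn_iff_logvol {T' : Finset ℕ} (hT' : ∀ p ∈ T', p.Prime) (h : D.T ⊆ T') :
    D.Cor312DHOn T' ↔ D.negAbsLogqDHOn T' ≤ D.negLogThetaDHOn T' := by
  rw [Cor312DHOn, D.negAbsLogqDHOn_eq hT' h]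

/-- **`Cor312DHOn` is monotone in the prime set**: for `T ⊆ T₁ ⊆ T₂` (primes), `Cor312DHOn T₁ → Cor312DHOn T₂`
(the larger the prime set, the WEAKER the truncated inequality). [claim: Mochizuki2012, status: disputed] -/
theorem cor312DHOn_mono {T₁ T₂ : Finset ℕ} (h₁ : D.T ⊆ T₁) (h₁₂ : T₁ ⊆ T₂) (hT₂ : ∀ p ∈ T₂, p.Prime) :
    D.Cor312DHOn T₁ → D.Cor312DHOn T₂ :=
  fun hD => hD.trans (D.negLogThetaDHOn_mono h₁ h₁₂ hT₂)

/-- **The landed `Cor312DH` is the STRONGEST truncation**: it implies `Cor312DHOn T'` for every finite set of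
primes `T' ⊇ T` — in particular it implies (1.1) as printed, not conversely (R7-C3-F1).
[claim: Mochizuki2012, status: disputed] -/
theorem cor312DHOn_of_cor312DH {T' : Finset ℕ} (h : D.T ⊆ T') (hT' : ∀ p ∈ T', p.Prime)
    (hD : D.Cor312DH) : D.Cor312DHOn T' :=
  D.cor312DHOn_mono le_rfl h hT' hD

/-- The free inequality over any `T' ⊇ T`: `−deĝ̲_lgp(P_Θ) ≤ ln ν̄_{𝕃,T'}(hull(U_Θ))`.
[cite: DupuyHilado2025, §4.10–4.12] -/
theorem free_inequalityOn {T' : Finset ℕ} (hT' : ∀ p ∈ T', p.Prime) (h : D.T ⊆ T') :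
    -LgpDivisor.ndegLgp D.X.thetaPilot ≤ D.negLogThetaDHOn T' := by
  rw [← D.lnνL_regionΘ_on hT' h, negLogThetaDHOn]
  refine D.M.lnνL_mono D.X.lstar T' (D.M.region_adm D.tΘ) D.hull_adm fun p j e => ?_
  exact (D.M.region_subset_UTheta_one D.ind3 p j e).trans (D.M.UTheta_le_hullUTheta D.ind3 _ p j e)

/-- (1.1) over `T'` ⟺ inflation by at least `deĝ̲_lgp(P_Θ) − deĝ̲(P_q)`, measured over `T'`.
[claim: Mochizuki2012, status: disputed] -/
theorem cor312DHOn_iff_inflation {T' : Finset ℕ} (hT' : ∀ p ∈ T', p.Prime) (h : D.T ⊆ T') :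
    D.Cor312DHOn T' ↔ LgpDivisor.ndegLgp D.X.thetaPilot - FinDivisor.ndeg F D.X.qPilot ≤
      D.negLogThetaDHOn T' - D.M.lnνL D.X.lstar T' (D.M.region D.tΘ) := by
  rw [Cor312DHOn, D.lnνL_regionΘ_on hT' h]
  constructor <;> intro hh <;> linarith

/-- **Support hypothesis** for the truncation: off the finite set `T₀`, every component of `hull(U_Θ)` at a
prime has normalised log-measure `0` (at such `p` the hull is the integral structure: [IUTchIV] Prop. 1.4
(iv) "`φ((R_I)^∼) ⊆ (R_I)^∼`" if `p > 2`, `e_i = 1`, and Thm. 1.10 Step (vi), off `V^dst`). An OBLIGATION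
of the concrete model for a suitable `T₀ ⊇ V^dst`; not assumed by any declaration above.
[cite: Mochizuki2012, IUTchIV Prop. 1.4 (iv) p. 13] -/
def HullSupportedOn (T₀ : Finset ℕ) : Prop :=
  ∀ p : ℕ, p.Prime → p ∉ T₀ → ∀ (j : ℕ) (e : Fin (j + 1) → placesOver F p),
    D.M.logμ (D.M.hullUTheta D.ind3 p j e) = 0

/-- Under the support hypothesis the `p`-part of `hull(U_Θ)` has `ln ν̄_{𝕃_p} = 0` off `T₀`.
[cite: DupuyHilado2025, Def. 3.6.3] -/
theorem lnνLp_hullUTheta_eq_zero_of_hullSupportedOn {T₀ : Finset ℕ} (hS : D.HullSupportedOn T₀) {p : ℕ}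
    (hp : p.Prime) (hpT : p ∉ T₀) : D.M.lnνLp D.X.lstar p (D.M.hullUTheta D.ind3) = 0 := by
  unfold PacketModel.lnνLp PacketModel.lnνTensorPower
  simp [hS p hp hpT]

/-- **Stabilisation**: under `HullSupportedOn T₀`, `ln ν̄_{𝕃,T'}(hull(U_Θ)) = ln ν̄_{𝕃,T₀}(hull(U_Θ))` for every
finite set of primes `T' ⊇ T₀` — the finite sum over `T₀` IS Dupuy–Hilado's `Σ_p`.
[cite: DupuyHilado2025, §1 p. 4, Def. 3.6.3] -/
theorem negLogThetaDHOn_eq_of_hullSupportedOn {T₀ T' : Finset ℕ} (hS : D.HullSupportedOn T₀)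
    (h : T₀ ⊆ T') (hT' : ∀ p ∈ T', p.Prime) : D.negLogThetaDHOn T' = D.negLogThetaDHOn T₀ := by
  unfold negLogThetaDHOn PacketModel.lnνL
  exact (Finset.sum_subset h fun p hp' hp₀ =>
    D.lnνLp_hullUTheta_eq_zero_of_hullSupportedOn hS (hT' p hp') hp₀).symm

/-- Under `HullSupportedOn T₀`, all truncations to `T' ⊇ T₀` are EQUIVALENT to the one over `T₀`.
[claim: Mochizuki2012, status: disputed] -/
theorem cor312DHOn_iff_of_hullSupportedOn {T₀ T' : Finset ℕ} (hS : D.HullSupportedOn T₀) (h : T₀ ⊆ T')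
    (hT' : ∀ p ∈ T', p.Prime) : D.Cor312DHOn T' ↔ D.Cor312DHOn T₀ := by
  rw [Cor312DHOn, Cor312DHOn, D.negLogThetaDHOn_eq_of_hullSupportedOn hS h hT']

/-- **(1.1) with `Σ_p`**, read as the limit of its monotone finite truncations: EVENTUALLY, along the
directed set of finite sets of primes containing `T`, `−deĝ̲(P_q) ≤ ln ν̄_{𝕃,T'}(hull(U_Θ))`. This is
Dupuy–Hilado (1.1) as printed (`Σ_p` over all primes, in `ℝ ∪ {+∞}`; `p = ∞` out of scope); it is implied
by every truncation (`cor312DHLim_of_cor312DHOn`), in particular by `Cor312DH`, and under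
`HullSupportedOn T₀` it is EQUIVALENT to `Cor312DHOn T₀`. HYPOTHESIS, never asserted.
[claim: Mochizuki2012, status: disputed] -/
@[claim "Mochizuki2012" "disputed"]
def Cor312DHLim : Prop :=
  ∃ T₁ : Finset ℕ, D.T ⊆ T₁ ∧ (∀ p ∈ T₁, p.Prime) ∧
    ∀ T' : Finset ℕ, T₁ ⊆ T' → (∀ p ∈ T', p.Prime) → D.Cor312DHOn T'

/-- Any one truncation over `T' ⊇ T` gives (1.1) with `Σ_p` (monotonicity). [claim: Mochizuki2012, status: disputed] -/
theorem cor312DHLim_of_cor312DHOn {T' : Finset ℕ} (h : D.T ⊆ T') (hT' : ∀ p ∈ T', p.Prime)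
    (hD : D.Cor312DHOn T') : D.Cor312DHLim :=
  ⟨T', h, hT', fun _ h'' hT'' => D.cor312DHOn_mono h h'' hT'' hD⟩

/-- `Cor312DH` (the truncation to `T`) gives (1.1) with `Σ_p`. [claim: Mochizuki2012, status: disputed] -/
theorem cor312DHLim_of_cor312DH (hD : D.Cor312DH) : D.Cor312DHLim :=
  D.cor312DHLim_of_cor312DHOn le_rfl D.T_prime hD

/-- **Under the support hypothesis, (1.1) with `Σ_p` ⟺ the truncation to `T₀`** (`T ⊆ T₀`, primes).
[claim: Mochizuki2012, status: disputed] -/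
theorem cor312DHLim_iff_of_hullSupportedOn {T₀ : Finset ℕ} (hS : D.HullSupportedOn T₀) (h : D.T ⊆ T₀)
    (hT₀ : ∀ p ∈ T₀, p.Prime) : D.Cor312DHLim ↔ D.Cor312DHOn T₀ := by
  constructor
  · rintro ⟨T₁, _, hT₁p, hall⟩
    have hU : ∀ p ∈ T₀ ∪ T₁, p.Prime := fun p hp =>
      (Finset.mem_union.mp hp).elim (hT₀ p) (hT₁p p)
    exact (D.cor312DHOn_iff_of_hullSupportedOn hS Finset.subset_union_left hU).mp
      (hall (T₀ ∪ T₁) Finset.subset_union_right hU)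
  · exact fun hD => D.cor312DHLim_of_cor312DHOn h hT₀ hD

/-- The multiradial ESTIMATE over `T'`: `ln ν̄_{𝕃,T'}(hull(U_Θ)) ≤ ln ν̄_{𝕃,T'}(O_𝕃(−P_Θ)) + δ`. Over a LARGER
`T'` this is a STRONGER hypothesis; the `δ` of [IUTchIV] Thm. 1.10 Steps (iv)–(x) is for `T' ⊇ V^dst` and
carries the log-different terms `log(𝔡)`. HYPOTHESIS. [claim: Mochizuki2012, status: disputed] -/
@[claim "Mochizuki2012" "disputed"]
def EstimateDHOn (T' : Finset ℕ) (δ : ℝ) : Prop :=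
  D.negLogThetaDHOn T' ≤ D.M.lnνL D.X.lstar T' (D.M.region D.tΘ) + δ

/-- `EstimateDH δ = EstimateDHOn T δ`. [claim: Mochizuki2012, status: disputed] -/
theorem estimateDHOn_self_iff (δ : ℝ) : D.EstimateDHOn D.T δ ↔ D.EstimateDH δ := Iff.rfl

/-- The squeeze over `T'`: (1.1) over `T'` and the estimate over `T'` give `deĝ̲_lgp(P_Θ) − deĝ̲(P_q) ≤ δ`.
[claim: Mochizuki2012, status: disputed] -/
theorem gap_le_of_cor312DHOn_of_estimateDHOn {T' : Finset ℕ} {δ : ℝ} (hT' : ∀ p ∈ T', p.Prime)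
    (h : D.T ⊆ T') (h1 : D.Cor312DHOn T') (h2 : D.EstimateDHOn T' δ) :
    LgpDivisor.ndegLgp D.X.thetaPilot - FinDivisor.ndeg F D.X.qPilot ≤ δ := by
  have := (D.cor312DHOn_iff_inflation hT' h).mp h1
  unfold EstimateDHOn at h2
  linarith

/-- … i.e. `deĝ̲(P_q) ≤ δ/(w̄ − 1)`, `w̄ = (ℓ⋇+1)(2ℓ⋇+1)/6`, from the truncations over any `T' ⊇ T`.
[claim: Mochizuki2012, status: disputed] -/
theorem ndeg_qPilot_le_of_squeezeOn {T' : Finset ℕ} {δ : ℝ} (hT' : ∀ p ∈ T', p.Prime) (h : D.T ⊆ T')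
    (h1 : D.Cor312DHOn T') (h2 : D.EstimateDHOn T' δ) :
    FinDivisor.ndeg F D.X.qPilot ≤ δ / (((D.X.lstar : ℝ) + 1) * (2 * D.X.lstar + 1) / 6 - 1) := by
  have hgap := D.gap_le_of_cor312DHOn_of_estimateDHOn hT' h h1 h2
  have hw : 0 < ((D.X.lstar : ℝ) + 1) * (2 * D.X.lstar + 1) / 6 - 1 := by
    have := D.X.one_lt_avgWeight; linarith
  have hΘ : LgpDivisor.ndegLgp D.X.thetaPilot =
      (((D.X.lstar : ℝ) + 1) * (2 * D.X.lstar + 1) / 6) * FinDivisor.ndeg F D.X.qPilot := by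
    rw [LgpDivisor.ndegLgp_eq, D.X.degLgp_thetaPilot, FinDivisor.ndeg_apply]
    ring
  rw [le_div_iff₀ hw]
  rw [hΘ] at hgap
  linarith

end DHData

end Summit.ABC.IUTFork

end
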